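import Mathlib
import Summits.ValiantsHypothesis.ValiantsHypothesis.Theorems.LacunarySymmetroidMatrixDescartesCensusWindowFourWitness

/-!
# `MatrixDescartes` census — WINDOW-4 ONE-POINT WITNESS ROWS via the common centre of the two killed trinomials

HONEST FRAMING.  Object-search cell `pub-symmetroid`, door-A target `DoorA26 := PosRootLawAt 2 6 19`
(stmt-ValiantsHypothesis-19979; OPEN, typed, never asserted).  Companion of `…CensusWindowFourWitness` (two-point witness
rows).  For the window 4-nomial `g = a − b X^u + c X^(u+v) − e X^(u+v+w)` (`a, b, e > 0`) the kill-0 trinomial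
`T₂(x) = u·b − (u+v)·c x^v + (u+v+w)·e x^(v+w)` and the kill-`b` twist `Φ(x) = u·a − v·c x^(u+v) + (v+w)·e x^(u+v+w)` are
CONCENTRIC (val-sym-door-p2 g7, THINK-g7.md §7 FACT 2): both have derivative sign `sign((v+w)(u+v+w)·e·x^w − v(u+v)·c)`, so
both decrease left of the common centre `x_c` (`(v+w)(u+v+w)·e·x_c^w = v(u+v)·c`) and increase right of it.  Hence ONE point
suffices as a certificate:

* `fourNomial_card_posRoots_le_two_of_left_centre_witness` — `0 < r`, `(v+w)(u+v+w)·e·r^w ≤ v(u+v)·c` (r at or left of the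
  centre), `T₂(r) < 0`, `Φ(r) > 0` ⇒ `#Z₊(g) ≤ 2`;
* `fourNomial_card_posRoots_le_two_of_right_centre_witness` — `0 < r`, `v(u+v)·c ≤ (v+w)(u+v+w)·e·r^w`, `T₂(r) > 0`,
  `Φ(r) < 0` ⇒ `#Z₊(g) ≤ 2`.

These are the rows that stay usable where the two-point rows pinch (Φ's root interval shrinking to the centre as the skip slack
σ_ACD → 0⁺): every hypothesis is one polynomial sign condition at a rational point, affine in each coefficient.  Nothing here
bounds any census count; `DoorA26` OPEN; nothing on `MatrixDescartes` (stmt-ValiantsHypothesis-18050) or `VP ≠ VNP`.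

[folklore] Derivative sign of a trinomial on one side of its critical point + the interlacing lemma; elementary.
-/

-- `Summit.ValiantsHypothesis.ValiantsHypothesis.…` repeats a component by the D-0017 layout
-- (single-conjunct summit), which the `dupNamespace` linter flags; the name is mandated.
set_option linter.dupNamespace false

namespace Summit.ValiantsHypothesis.ValiantsHypothesis.Theorems.LacunarySymmetroidMatrixDescartes.Census

open Polynomial Finset Set
open scoped BigOperators Polynomial

/-- Derivative of the trinomial `α − β x^p + γ x^q` (`p, q ≥ 1`). [folklore] -/
theorem hasDerivAt_trinomial (α β γ : ℝ) (p q : ℕ) (x : ℝ) :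
    HasDerivAt (fun x : ℝ => α - β * x ^ p + γ * x ^ q)
      (-(β * ((p : ℝ) * x ^ (p - 1))) + γ * ((q : ℝ) * x ^ (q - 1))) x := by
  have h : HasDerivAt (fun y : ℝ => α - β * y ^ p + γ * y ^ q)
      (0 - β * ((p : ℝ) * x ^ (p - 1)) + γ * ((q : ℝ) * x ^ (q - 1))) x :=
    ((hasDerivAt_const x α).sub ((hasDerivAt_pow p x).const_mul β)).add ((hasDerivAt_pow q x).const_mul γ)
  exact h.congr_deriv (by ring)

/-- **One-sided monotonicity right of a pivot.**  If `1 ≤ p < q` and the pivot `r > 0` satisfies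
`p·β ≤ q·γ·r^(q−p)` (r at or right of the critical point; `γ ≥ 0`), then `α − β x^p + γ x^q` is monotone on `[r, ∞)`.
[folklore] -/
theorem trinomial_monotoneOn_Ici {p q : ℕ} (hp : 0 < p) (hpq : p < q) {α β γ r : ℝ} (hγ : 0 ≤ γ)
    (hr : 0 < r) (hcen : (p : ℝ) * β ≤ (q : ℝ) * γ * r ^ (q - p)) :
    MonotoneOn (fun x : ℝ => α - β * x ^ p + γ * x ^ q) (Ici r) := by
  apply monotoneOn_of_deriv_nonneg (convex_Ici r)
  · exact (Continuous.continuousOn (by fun_prop))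
  · intro x _; exact (hasDerivAt_trinomial α β γ p q x).differentiableAt.differentiableWithinAt
  · intro x hx
    rw [interior_Ici] at hx
    have hxr : r < x := hx
    have hx0 : 0 < x := hr.trans hxr
    rw [(hasDerivAt_trinomial α β γ p q x).deriv]
    -- x^(q-1) = x^(p-1) * x^(q-p), and r^(q-p) ≤ x^(q-p)
    have hqp : q - 1 = (p - 1) + (q - p) := by omega
    have hpow : r ^ (q - p) ≤ x ^ (q - p) := pow_le_pow_left₀ hr.le hxr.le _
    have hxp : 0 < x ^ (p - 1) := pow_pos hx0 _
    rw [hqp, pow_add]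
    have : β * ((p : ℝ) * x ^ (p - 1)) ≤ γ * ((q : ℝ) * (x ^ (p - 1) * x ^ (q - p))) := by
      have h1 : (p : ℝ) * β * x ^ (p - 1) ≤ (q : ℝ) * γ * r ^ (q - p) * x ^ (p - 1) :=
        mul_le_mul_of_nonneg_right hcen hxp.le
      have h2 : (q : ℝ) * γ * r ^ (q - p) * x ^ (p - 1) ≤ (q : ℝ) * γ * x ^ (q - p) * x ^ (p - 1) := by
        apply mul_le_mul_of_nonneg_right _ hxp.le
        exact mul_le_mul_of_nonneg_left hpow (by positivity)
      nlinarith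
    linarith

/-- **One-sided antitonicity left of a pivot.**  If `1 ≤ p < q` and the pivot `r` satisfies
`q·γ·r^(q−p) ≤ p·β` (r at or left of the critical point; `γ ≥ 0`), then `α − β x^p + γ x^q` is antitone on `[0, r]`.
[folklore] -/
theorem trinomial_antitoneOn_Icc {p q : ℕ} (hp : 0 < p) (hpq : p < q) {α β γ r : ℝ} (hγ : 0 ≤ γ)
    (hcen : (q : ℝ) * γ * r ^ (q - p) ≤ (p : ℝ) * β) :
    AntitoneOn (fun x : ℝ => α - β * x ^ p + γ * x ^ q) (Icc 0 r) := by
  apply antitoneOn_of_deriv_nonpos (convex_Icc 0 r)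
  · exact (Continuous.continuousOn (by fun_prop))
  · intro x _; exact (hasDerivAt_trinomial α β γ p q x).differentiableAt.differentiableWithinAt
  · intro x hx
    rw [interior_Icc] at hx
    have hx0 : 0 < x := hx.1
    have hxr : x < r := hx.2
    rw [(hasDerivAt_trinomial α β γ p q x).deriv]
    have hqp : q - 1 = (p - 1) + (q - p) := by omega
    have hpow : x ^ (q - p) ≤ r ^ (q - p) := pow_le_pow_left₀ hx0.le hxr.le _
    have hxp : 0 < x ^ (p - 1) := pow_pos hx0 _
    rw [hqp, pow_add]
    have : γ * ((q : ℝ) * (x ^ (p - 1) * x ^ (q - p))) ≤ β * ((p : ℝ) * x ^ (p - 1)) := by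
      have h1 : (q : ℝ) * γ * x ^ (q - p) * x ^ (p - 1) ≤ (q : ℝ) * γ * r ^ (q - p) * x ^ (p - 1) := by
        apply mul_le_mul_of_nonneg_right _ hxp.le
        exact mul_le_mul_of_nonneg_left hpow (by positivity)
      have h2 : (q : ℝ) * γ * r ^ (q - p) * x ^ (p - 1) ≤ (p : ℝ) * β * x ^ (p - 1) :=
        mul_le_mul_of_nonneg_right hcen hxp.le
      nlinarith
    linarith

/-- **WINDOW-4 LEFT CENTRE-WITNESS ROW.**  `0 < r` at or left of the common centre
(`(v+w)(u+v+w)·e·r^w ≤ v(u+v)·c`), `T₂(r) < 0` and `Φ(r) > 0` ⇒ the window 4-nomial has at most two positive roots.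
(With three roots: `T₂(r) < 0` puts `s₁ < r`; `Φ` is antitone on `[0, r]`, so `Φ(s₁) ≥ Φ(r) > 0`, against
`Φ(s₁) < 0`.) [folklore] -/
theorem fourNomial_card_posRoots_le_two_of_left_centre_witness {u v w : ℕ} (hu : 0 < u) (hv : 0 < v) (hw : 0 < w)
    {a b c e : ℝ} (ha : 0 < a) (hb : 0 < b) (he : 0 < e) {r : ℝ} (hr : 0 < r)
    (hcen : ((v : ℝ) + w) * ((u : ℝ) + v + w) * e * r ^ w ≤ (v : ℝ) * ((u : ℝ) + v) * c)
    (hT₂r : (u : ℝ) * b - ((u : ℝ) + v) * c * r ^ v + ((u : ℝ) + v + w) * e * r ^ (v + w) < 0)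
    (hΦr : 0 < (u : ℝ) * a - (v : ℝ) * c * r ^ (u + v) + ((v : ℝ) + w) * e * r ^ (u + v + w)) :
    ((C a - C b * X ^ u + C c * X ^ (u + v) - C e * X ^ (u + v + w)).roots.toFinset.filter
      (fun x => 0 < x)).card ≤ 2 := by
  by_contra hnot
  have h3 : 3 ≤ ((C a - C b * X ^ u + C c * X ^ (u + v) - C e * X ^ (u + v + w)).roots.toFinset.filter
      (fun x => 0 < x)).card := by omega
  obtain ⟨s₁, s₂, hs₁, hs₁₂, hT₂s₁, hT₂s₂, hΦs₁, hΦs₂⟩ :=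
    fourNomial_interlacing_of_three_posRoots' hu hv hw ha hb h3
  set T₂ : ℝ → ℝ := fun x => (u : ℝ) * b - ((u : ℝ) + v) * c * x ^ v + ((u : ℝ) + v + w) * e * x ^ (v + w)
    with hT₂def
  have cT₂ : Continuous T₂ := by rw [hT₂def]; fun_prop
  have hvw : 0 < v + w := Nat.add_pos_left hv w
  have noT₂ : ∀ ρ₁ ρ₂ ρ₃ : ℝ, 0 < ρ₁ → ρ₁ < ρ₂ → ρ₂ < ρ₃ → T₂ ρ₁ = 0 → T₂ ρ₂ = 0 → T₂ ρ₃ = 0 → False := by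
    intro ρ₁ ρ₂ ρ₃ h1 h12 h23 e1 e2 e3
    have hx : (u : ℝ) * b ≠ 0 := by positivity
    refine trinomial_three_posRoots_false (x := (u : ℝ) * b) (y := -(((u : ℝ) + v) * c))
      (z := ((u : ℝ) + v + w) * e) hv hvw hx h1 h12 h23 ?_ ?_ ?_
    · simp only [hT₂def] at e1; linarith
    · simp only [hT₂def] at e2; linarith
    · simp only [hT₂def] at e3; linarith
  have hT₂0 : 0 < T₂ 0 := by
    simp only [hT₂def, zero_pow hv.ne', zero_pow hvw.ne', mul_zero, add_zero, sub_zero]; positivity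
  have eT₂s₁ : T₂ s₁ = 0 := hT₂s₁
  have eT₂s₂ : T₂ s₂ = 0 := hT₂s₂
  have nT₂r : T₂ r < 0 := hT₂r
  -- s₁ < r
  have hs₁r : s₁ < r := by
    rcases lt_trichotomy r s₁ with hlt | heq | hgt
    · obtain ⟨ρ, hρ0, hρr, hρ⟩ := exists_zero_Ioo_of_pos_of_neg cT₂ hr hT₂0 nT₂r
      exact (noT₂ ρ s₁ s₂ hρ0 (hρr.trans hlt) hs₁₂ hρ eT₂s₁ eT₂s₂).elim
    · rw [heq] at nT₂r; exact absurd eT₂s₁ nT₂r.ne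
    · exact hgt
  -- Φ antitone on [0, r]  (p = u+v, q = u+v+w, q - p = w)
  have hanti := trinomial_antitoneOn_Icc (α := (u : ℝ) * a) (β := (v : ℝ) * c) (γ := ((v : ℝ) + w) * e)
    (p := u + v) (q := u + v + w) (r := r) (Nat.add_pos_left hu v) (by omega) (by positivity)
    (by
      have hqp : u + v + w - (u + v) = w := by omega
      rw [hqp]; push_cast; nlinarith [hcen])
  have hmem₁ : s₁ ∈ Icc (0 : ℝ) r := ⟨hs₁.le, hs₁r.le⟩
  have hmem₂ : r ∈ Icc (0 : ℝ) r := ⟨hr.le, le_rfl⟩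
  have hge := hanti hmem₁ hmem₂ hs₁r.le
  -- hge : Φ r ≤ Φ s₁
  have : (u : ℝ) * a - (v : ℝ) * c * r ^ (u + v) + ((v : ℝ) + w) * e * r ^ (u + v + w)
      ≤ (u : ℝ) * a - (v : ℝ) * c * s₁ ^ (u + v) + ((v : ℝ) + w) * e * s₁ ^ (u + v + w) := hge
  linarith

/-- **WINDOW-4 RIGHT CENTRE-WITNESS ROW.**  `0 < r` at or right of the common centre
(`v(u+v)·c ≤ (v+w)(u+v+w)·e·r^w`), `T₂(r) > 0` and `Φ(r) < 0` ⇒ the window 4-nomial has at most two positive roots.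
(`T₂` is monotone on `[r, ∞)`, so `T₂(r) > 0 = T₂(s₂)` forces `s₂ < r`; then `Φ` changes sign on `(0,s₁)`, `(s₁,s₂)`,
`(s₂,r)`.) [folklore] -/
theorem fourNomial_card_posRoots_le_two_of_right_centre_witness {u v w : ℕ} (hu : 0 < u) (hv : 0 < v) (hw : 0 < w)
    {a b c e : ℝ} (ha : 0 < a) (hb : 0 < b) (he : 0 < e) {r : ℝ} (hr : 0 < r)
    (hcen : (v : ℝ) * ((u : ℝ) + v) * c ≤ ((v : ℝ) + w) * ((u : ℝ) + v + w) * e * r ^ w)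
    (hT₂r : 0 < (u : ℝ) * b - ((u : ℝ) + v) * c * r ^ v + ((u : ℝ) + v + w) * e * r ^ (v + w))
    (hΦr : (u : ℝ) * a - (v : ℝ) * c * r ^ (u + v) + ((v : ℝ) + w) * e * r ^ (u + v + w) < 0) :
    ((C a - C b * X ^ u + C c * X ^ (u + v) - C e * X ^ (u + v + w)).roots.toFinset.filter
      (fun x => 0 < x)).card ≤ 2 := by
  by_contra hnot
  have h3 : 3 ≤ ((C a - C b * X ^ u + C c * X ^ (u + v) - C e * X ^ (u + v + w)).roots.toFinset.filter
      (fun x => 0 < x)).card := by omega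
  obtain ⟨s₁, s₂, hs₁, hs₁₂, hT₂s₁, hT₂s₂, hΦs₁, hΦs₂⟩ :=
    fourNomial_interlacing_of_three_posRoots' hu hv hw ha hb h3
  set Φ : ℝ → ℝ := fun x => (u : ℝ) * a - (v : ℝ) * c * x ^ (u + v) + ((v : ℝ) + w) * e * x ^ (u + v + w)
    with hΦdef
  have cΦ : Continuous Φ := by rw [hΦdef]; fun_prop
  have huv : 0 < u + v := Nat.add_pos_left hu v
  have huvw : 0 < u + v + w := Nat.add_pos_left huv w
  have noΦ : ∀ ρ₁ ρ₂ ρ₃ : ℝ, 0 < ρ₁ → ρ₁ < ρ₂ → ρ₂ < ρ₃ → Φ ρ₁ = 0 → Φ ρ₂ = 0 → Φ ρ₃ = 0 → False := by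
    intro ρ₁ ρ₂ ρ₃ h1 h12 h23 e1 e2 e3
    have hx : (u : ℝ) * a ≠ 0 := by positivity
    refine trinomial_three_posRoots_false (x := (u : ℝ) * a) (y := -((v : ℝ) * c))
      (z := ((v : ℝ) + w) * e) huv huvw hx h1 h12 h23 ?_ ?_ ?_
    · simp only [hΦdef] at e1; linarith
    · simp only [hΦdef] at e2; linarith
    · simp only [hΦdef] at e3; linarith
  have hΦ0 : 0 < Φ 0 := by
    simp only [hΦdef, zero_pow huv.ne', zero_pow huvw.ne', mul_zero, add_zero, sub_zero]; positivity
  have nΦs₁ : Φ s₁ < 0 := hΦs₁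
  have pΦs₂ : 0 < Φ s₂ := hΦs₂
  have nΦr : Φ r < 0 := hΦr
  -- s₂ < r from the monotonicity of T₂ on [r, ∞)  (p = v, q = v+w, q - p = w)
  have hmono := trinomial_monotoneOn_Ici (α := (u : ℝ) * b) (β := ((u : ℝ) + v) * c) (γ := ((u : ℝ) + v + w) * e)
    (p := v) (q := v + w) hv (by omega) (by positivity) hr
    (by
      have hqp : v + w - v = w := by omega
      rw [hqp]; push_cast; nlinarith [hcen])
  have hs₂r : s₂ < r := by
    by_contra hle
    have hle' : r ≤ s₂ := not_lt.mp hle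
    have hmem₁ : r ∈ Ici r := Set.mem_Ici.mpr le_rfl
    have hmem₂ : s₂ ∈ Ici r := Set.mem_Ici.mpr hle'
    have hge := hmono hmem₁ hmem₂ hle'
    have : (u : ℝ) * b - ((u : ℝ) + v) * c * r ^ v + ((u : ℝ) + v + w) * e * r ^ (v + w)
        ≤ (u : ℝ) * b - ((u : ℝ) + v) * c * s₂ ^ v + ((u : ℝ) + v + w) * e * s₂ ^ (v + w) := hge
    linarith
  obtain ⟨ρ₁, hρ₁0, hρ₁1, eρ₁⟩ := exists_zero_Ioo_of_pos_of_neg cΦ hs₁ hΦ0 nΦs₁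
  obtain ⟨ρ₂, hρ₂0, hρ₂1, eρ₂⟩ := exists_zero_Ioo_of_neg_of_pos cΦ hs₁₂ nΦs₁ pΦs₂
  obtain ⟨ρ₃, hρ₃0, hρ₃1, eρ₃⟩ := exists_zero_Ioo_of_pos_of_neg cΦ hs₂r pΦs₂ nΦr
  exact noΦ ρ₁ ρ₂ ρ₃ hρ₁0 (hρ₁1.trans hρ₂0) (hρ₂1.trans hρ₃0) eρ₁ eρ₂ eρ₃

end Summit.ValiantsHypothesis.ValiantsHypothesis.Theorems.LacunarySymmetroidMatrixDescartes.Census
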